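import Summits.CriticalPhenomena.PercolationContinuityZ3.Theorems.PercNearOneGluingNoHeavyLowerTailThreePointDiamondAnyEdge
import Summits.CriticalPhenomena.PercolationContinuityZ3.Theorems.PercNearOneGluingNoHeavyConstsThreePointDiamond
import HarnessLib

/-!
# `Consts.ThreePointDiamond` holds

Support file for crux `stmt-CriticalPhenomena-4575` (`NoHeavyLowerTail`), seat `prim-l12-p1` gen 22 (`--supports stmt-CriticalPhenomena-4575`).
Discharges the programme's open conjecture `Consts.ThreePointDiamond` (`…PercNearOneGluingNoHeavyConstsThreePointDiamond`, seat prim-consts-2 gen 18;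
the sign half of Gladkov's Conjecture 10.1 for Bernoulli percolation on finite graphs) from `ThreePointDiamondAnyEdge.diamond_cells`
(the diamond inequality `P(ac|b)·P(bc|a) ≤ P(abc)·P(a|b|c)` on every finite weighted graph, by concavity of the margin along every edge weight).
ATTRIBUTION: the inequality is a Gladkov–Zimin CONE ROW — the kernel `e_S⊗e_K − e_{J_a}⊗e_{J_b}` is cover-supermodular on `Π₃` (`J_a, J_b` are
atoms and coatoms) — so it is also an instance of the tree's general theorem `KernelRows.prodBernoulli_gzRow` (prim-ineq-gen-1, `…LowerTailKernelRowsGZ`)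
with `Q = Π₃`, `κ(S,K) = κ(K,S) = ½`, `κ(J_a,J_b) = κ(J_b,J_a) = −½`; the conjecture's 'open' status in `…ConstsThreePointDiamond` predates that observation.
No definitions, no sorries, standard axioms.
-/

namespace Summit.CriticalPhenomena.PercolationContinuityZ3.Theorems.ThreePointDiamondAnyEdge

open MeasureTheory Set
open Literature.Probability.Percolation Literature.Probability.LatticeModels

/-- **`Consts.ThreePointDiamond` holds** (the three-point diamond conjecture of prim-consts-2 gen 18; sign half of Gladkov's Conjecture 10.1 for
Bernoulli percolation on finite graphs): `P(c↔a, c↮b)·P(c↔b, c↮a) ≤ P(c↔a, c↔b)·P(c↮a, c↮b, a↮b)` for all `n`, all weights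
`w : Sym2 (Fin n) → [0,1]` and all `a, b, c`. [this work] -/
theorem threePointDiamond_holds : Consts.ThreePointDiamond := by
  intro n w a b c
  have h := diamond_cells w a b c
  have e1 : (openConn c a : Set (BondConfig (Fin n))) = openConn a c := KNPreFKG.openConn_symm c a
  have e2 : (openConn c b : Set (BondConfig (Fin n))) = openConn b c := KNPreFKG.openConn_symm c b
  have e3 : ((openConn c a)ᶜ ∩ (openConn c b)ᶜ ∩ (openConn a b)ᶜ : Set (BondConfig (Fin n))) =
      (openConn a b)ᶜ ∩ (openConn a c)ᶜ ∩ (openConn b c)ᶜ := by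
    rw [e1, e2]; ext ω; simp only [mem_inter_iff]; tauto
  rw [e3, e1, e2]
  exact h

end Summit.CriticalPhenomena.PercolationContinuityZ3.Theorems.ThreePointDiamondAnyEdge
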